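import Summits.QuantumFields.YangMills.Theorems.BalabanLadderUVSeamRecChessboardPlaquetteExpMomentLinear
import Summits.QuantumFields.YangMills.Theorems.BalabanLadderUVSeamRecCarrierCubePlaquettes
import Summits.QuantumFields.YangMills.Theorems.BalabanLadderUVSeamRecCarrierExpMomentsDefs
import Summits.QuantumFields.YangMills.Theorems.BalabanLadderUVSeamRecResponseMomentsPinning
import HarnessLib

/-!
# Crux `UVSeamRec` (stmt-QuantumFields-20043), line `coldwall_pure`: (EM_Q) for the classical carriers holds UNIFORMLY IN THE SCALE `R`
# with a carrier constant `C ∝ R⁴(2R+4)⁴` — the budget of the rung is `B ≍ 2.5·10⁴·R⁴(2R+4)⁴/C`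

Helper file (`--supports stmt-QuantumFields-20043`) of the LEAD seat `ym-spine-20043-p1` (gen 17); sequel of `…CarrierExpMomentFixedScale` (p641905, the
fixed-scale rung at `C = 24R⁴`) and `…ChessboardPlaquetteExpMomentLinear` (the small-`c` chessboard bound, exponent `(c/β)(1944 + 144 log β/M)` per
plaquette).  Registered stub `stub_gaussianDomination : GaussianDominationSU2` ⇒ binder `CarrierExpMomentsSU2` (p642194/p642615): SOME constant `C` and
budget `B` with `⟨exp(2 Σ_{i∈T} carrierCl C 1 β R (q i) (x i))⟩_{2L+1,β} ≤ exp(B·#T)` on the whole window `R·uRec β ≤ ℓ₁`.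

WHAT.  `SU(2)` fundamental, `β ≥ 4`, odd torus `(ℤ/(2L+1))⁴`, `1 ≤ R`, `4R+8 ≤ L`, cyclically `2R+4`-separated family, any `T`:
* `torusE_exp_two_mul_sum_carrierCl_le_of_const` — for EVERY carrier constant `C ≥ 24R⁴`:
  `⟨exp(2 Σ_{i∈T} carrierCl C 1 β R (q i) (x i))⟩_{2L+1,β} ≤ exp(12R⁴(2R+4)⁴(1944 + 144 log β/(2L+1))/C · #T)` — the budget is INVERSELY
  proportional to `C` (Gaussian-scale currency of the chessboard bound);
* `torusE_exp_two_mul_sum_carrierCl_le_uniform` — with the `R`-DEPENDENT constant `C = c₀R⁴(2R+4)⁴`, `c₀ ≥ 1`: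
  `⟨exp(2 Σ_{i∈T} carrierCl (c₀R⁴(2R+4)⁴) 1 β R (q i) (x i))⟩_{2L+1,β} ≤ exp(12(1944 + 144 log β/(2L+1))/c₀ · #T)` — a budget UNIFORM IN `R`
  (and in `β` on tori `2L+1 ≥ log β`: `25056/c₀`, `…_of_log_le`), volume-uniform, extensive, NO window condition.

LOCATED (numbers).  The (EM_Q) sentence of the binder is therefore TRUE uniformly in `R` at carrier constant `C ≍ R⁸` and TRUE at each fixed `R` at
`C = O(R⁴)`; the registered line needs it at `C = O(1)` uniformly in `R ≤ ℓ₁/uRec β` (the split (CW) pays coherent-flux exteriors only with an `O(1)`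
constant — `carrierCl C = βR⁴·classicalResponse/C`).  The open content of `stub_gaussianDomination` ∕ `CarrierExpMomentsSU2` is exactly the factor `R⁸`
(`R⁴` thermal cube energy in place of the minimiser's centre response `R⁻⁴`, both `× β`): coherence of the boundary data × volume — the
background-field expansion.

HONEST FRAMING: chessboard/Peierls bookkeeping; nothing of E0′, NT or the gap; YM mass gap NOT proved; not Clay.
-/

open MeasureTheory Finset
open Literature.MathematicalPhysics.QuantumFieldTheory (GaugeConfig LatticeRep wilsonMeasure wilsonExpectation
  isProbabilityMeasure_wilsonMeasure Plaquette)
open Literature.MathematicalPhysics.QuantumLattice (fundamentalRep fundamentalLatticeRep LGConfig ZdPlaquette plaquettesTouching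
  wilsonBoundaryAction torusLift continuous_wilsonBoundaryAction)
open Literature.Probability.LatticeModels (Torus.proj)
open Summit.QuantumFields.YangMills.Cruxes.OSLegsFromFemtoAndGap.DlrCollarTransfer
open Summit.QuantumFields.YangMills.Cruxes.UVSeamRec.BoundaryLawPenetration (wilsonBoundaryAction_nonneg)
open Summit.QuantumFields.YangMills.Cruxes.UVSeamRec.ResponsePinning (torusE_mono integrable_comp_lift torusE_const_mul' torusE_const)
open Summit.QuantumFields.YangMills.Theorems.SoloBlind (expObs plaquetteCost)
open Summit.QuantumFields.YangMills.Cruxes.UVSeamRec.Chessboard (su2_wilsonExpectation_expObs_le_linear)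

noncomputable section

namespace Summit.QuantumFields.YangMills.Cruxes.UVSeamRec.ClassicalResponse

/-- **(EM_Q) with budget inversely proportional to the carrier constant.**  `SU(2)` fundamental, `β ≥ 4`, odd torus `(ℤ/(2L+1))⁴`, `1 ≤ R`,
`4R+8 ≤ L`, a cyclically `2R+4`-separated family `(q i, x i)`, any `T`, any `C ≥ 24R⁴`:
`⟨exp(2 Σ_{i∈T} carrierCl C 1 β R (q i) (x i))⟩_{2L+1,β} ≤ exp(12R⁴(2R+4)⁴(1944 + 144 log β/(2L+1))/C · #T)`.
Classical bound `carrierCl C 1 ≤ (βR⁴/C)·S_cube` + one torus plaquette set (p641508) + the small-`c` chessboard bound at `c = 2βR⁴/C ≤ β/12`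
(`Chessboard.su2_wilsonExpectation_expObs_le_linear`). [folklore] -/
theorem torusE_exp_two_mul_sum_carrierCl_le_of_const {β : ℝ} (hβ : 4 ≤ β) {L n : ℕ} (q : Fin n → Fin 4 × Fin 4)
    (x : Fin n → (Fin 4 → ℤ)) {R : ℕ} (hq : ∀ i, (q i).1 < (q i).2) (hR : 1 ≤ R) (hRL : 4 * R + 8 ≤ L)
    (hsep : ∀ i j : Fin n, i ≠ j → ∃ k : Fin 4,
      (2 * (R : ℤ) + 4) ≤ |((((x i k - x j k : ℤ) : ZMod (2 * L + 1))).valMinAbs : ℤ)|)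
    {C : ℝ} (hC : 24 * (R : ℝ) ^ 4 ≤ C) (T : Finset (Fin n)) :
    torusE (Matrix.specialUnitaryGroup (Fin 2) ℂ) (fundamentalLatticeRep 2) β L
        (fun U => Real.exp (((2 : ℕ) : ℝ) * ∑ i ∈ T, carrierCl (fundamentalLatticeRep 2) C 1 β R (q i) (x i) U)) ≤
      Real.exp (12 * (R : ℝ) ^ 4 * (2 * R + 4) ^ 4 * (1944 + 144 * Real.log β / (2 * L + 1 : ℕ)) / C * #T) := by
  classical
  set rF : LatticeRep (Matrix.specialUnitaryGroup (Fin 2) ℂ) := fundamentalLatticeRep 2 with hrF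
  have hβ0 : 0 ≤ β := by linarith
  have hR0 : (1 : ℝ) ≤ R := by exact_mod_cast hR
  have hR4 : (1 : ℝ) ≤ (R : ℝ) ^ 4 := one_le_pow₀ hR0
  have hCpos : 0 < C := lt_of_lt_of_le (by positivity) hC
  -- the exponent scale `c = 2βR⁴/C ≤ β/12`
  set c : ℝ := 2 * β * (R : ℝ) ^ 4 / C with hc
  have hc0 : 0 ≤ c := by positivity
  have hcβ : c ≤ β / 12 := by
    rw [hc, div_le_div_iff₀ hCpos (by norm_num)]
    nlinarith
  -- the cube boundary actions
  set S : Fin n → LGConfig 4 (Matrix.specialUnitaryGroup (Fin 2) ℂ) → ℝ :=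
    fun i => wilsonBoundaryAction rF.ρ (cubeEdges (fun k => x i k - (R + 1)) (2 * R + 3)) with hS
  have hS0 : ∀ i U, 0 ≤ S i U := fun i U => wilsonBoundaryAction_nonneg rF _ U
  -- (1) pointwise: `2 Σ_i carrierCl C ≤ c Σ_i S_i`
  have hpt : ∀ U : LGConfig 4 (Matrix.specialUnitaryGroup (Fin 2) ℂ),
      Real.exp (((2 : ℕ) : ℝ) * ∑ i ∈ T, carrierCl rF C 1 β R (q i) (x i) U) ≤ Real.exp (c * ∑ i ∈ T, S i U) := by
    intro U
    refine Real.exp_le_exp.2 ?_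
    rw [mul_sum, mul_sum]
    refine sum_le_sum fun i _ => ?_
    have h1 := carrierCl_le_mul_wilsonBoundaryAction rF hCpos hβ0 R (q i) (hq i) (x i) U
    have h2 := mul_le_mul_of_nonneg_left h1 (show (0 : ℝ) ≤ ((2 : ℕ) : ℝ) by positivity)
    refine h2.trans (le_of_eq ?_)
    simp only [hc, hS]
    push_cast
    ring
  -- continuity
  have hcA : Continuous fun U : LGConfig 4 (Matrix.specialUnitaryGroup (Fin 2) ℂ) =>
      Real.exp (((2 : ℕ) : ℝ) * ∑ i ∈ T, carrierCl rF C 1 β R (q i) (x i) U) :=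
    Real.continuous_exp.comp (continuous_const.mul (continuous_finsetSum _ fun i _ =>
      continuous_const.mul (continuous_classicalResponse (r := rF) _ _ (q i) (x i) 1)))
  have hcS : ∀ i, Continuous (S i) := fun i => continuous_wilsonBoundaryAction rF.ρ rF.continuous _
  have hcB : Continuous fun U : LGConfig 4 (Matrix.specialUnitaryGroup (Fin 2) ℂ) => Real.exp (c * ∑ i ∈ T, S i U) :=
    Real.continuous_exp.comp (continuous_const.mul (continuous_finsetSum _ fun i _ => hcS i))
  refine (torusE_mono rF β L hcA hcB hpt).trans ?_
  -- (2) one torus plaquette set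
  set P : Finset (Plaquette 4 (2 * L + 1)) :=
    (T.sigma fun i => plaquettesTouching (cubeEdges (fun k => x i k - (R + 1)) (2 * R + 3))).image
      (fun ip : (Σ _ : Fin n, ZdPlaquette 4) => ((Torus.proj (2 * L + 1) ip.2.1, ip.2.2) : Plaquette 4 (2 * L + 1))) with hP
  have hobs : ∀ U : GaugeConfig 4 (2 * L + 1) (Matrix.specialUnitaryGroup (Fin 2) ℂ),
      Real.exp (c * ∑ i ∈ T, S i (torusLift (2 * L + 1) U)) =
        expObs (G := Matrix.specialUnitaryGroup (Fin 2) ℂ) (fundamentalRep (Fin 2)) c P U := by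
    intro U
    unfold expObs
    congr 1
    rw [hP, ← sum_wilsonBoundaryAction_torusLift_eq (fundamentalRep (Fin 2)) hRL x hsep T U]
    rfl
  have hE : torusE (Matrix.specialUnitaryGroup (Fin 2) ℂ) rF β L (fun U => Real.exp (c * ∑ i ∈ T, S i U)) =
      wilsonExpectation (fundamentalRep (Fin 2)) β (expObs (G := Matrix.specialUnitaryGroup (Fin 2) ℂ) (fundamentalRep (Fin 2)) c P) := by
    unfold torusE wilsonExpectation
    exact integral_congr_ae (ae_of_all _ fun U => hobs U)
  rw [hE]
  -- (3) the small-`c` chessboard bound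
  haveI : NeZero (2 * L + 1) := ⟨by omega⟩
  have hodd : Odd (2 * L + 1) := ⟨L, rfl⟩
  have h3 : 3 ≤ 2 * L + 1 := by omega
  refine (su2_wilsonExpectation_expObs_le_linear hodd h3 hβ hc0 hcβ P).trans (Real.exp_le_exp.2 ?_)
  have hK : 0 ≤ 1944 + 144 * Real.log β / ((2 * L + 1 : ℕ) : ℝ) := by
    have : 0 ≤ Real.log β := Real.log_nonneg (by linarith)
    positivity
  have hcard : (#P : ℝ) ≤ 6 * (2 * R + 4) ^ 4 * #T := by
    have h := card_image_sigma_torusPlaq_le (L := L) (R := R) x T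
    rw [← hP] at h
    exact_mod_cast h
  have hβne : β ≠ 0 := by linarith
  have hcb : c / β = 2 * (R : ℝ) ^ 4 / C := by
    rw [hc]; field_simp
  rw [hcb]
  have hq0 : 0 ≤ 2 * (R : ℝ) ^ 4 / C * (1944 + 144 * Real.log β / ((2 * L + 1 : ℕ) : ℝ)) := by positivity
  calc (#P : ℝ) * (2 * (R : ℝ) ^ 4 / C * (1944 + 144 * Real.log β / ((2 * L + 1 : ℕ) : ℝ)))
      ≤ 6 * (2 * R + 4) ^ 4 * #T * (2 * (R : ℝ) ^ 4 / C * (1944 + 144 * Real.log β / ((2 * L + 1 : ℕ) : ℝ))) :=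
        mul_le_mul_of_nonneg_right hcard hq0
    _ = 12 * (R : ℝ) ^ 4 * (2 * R + 4) ^ 4 * (1944 + 144 * Real.log β / (2 * L + 1 : ℕ)) / C * #T := by ring

/-- **(EM_Q) UNIFORMLY IN THE SCALE with the `R`-dependent carrier constant `C = c₀R⁴(2R+4)⁴` (`c₀ ≥ 1`)**: `β ≥ 4`, `1 ≤ R`, `4R+8 ≤ L`, separated
family, any `T`: `⟨exp(2 Σ_{i∈T} carrierCl (c₀R⁴(2R+4)⁴) 1 β R (q i) (x i))⟩_{2L+1,β} ≤ exp(12(1944 + 144 log β/(2L+1))/c₀ · #T)` — the budget does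
not depend on `R`; no window condition. [folklore] -/
theorem torusE_exp_two_mul_sum_carrierCl_le_uniform {β : ℝ} (hβ : 4 ≤ β) {L n : ℕ} (q : Fin n → Fin 4 × Fin 4)
    (x : Fin n → (Fin 4 → ℤ)) {R : ℕ} (hq : ∀ i, (q i).1 < (q i).2) (hR : 1 ≤ R) (hRL : 4 * R + 8 ≤ L)
    (hsep : ∀ i j : Fin n, i ≠ j → ∃ k : Fin 4,
      (2 * (R : ℤ) + 4) ≤ |((((x i k - x j k : ℤ) : ZMod (2 * L + 1))).valMinAbs : ℤ)|)
    {c₀ : ℝ} (hc₀ : 1 ≤ c₀) (T : Finset (Fin n)) :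
    torusE (Matrix.specialUnitaryGroup (Fin 2) ℂ) (fundamentalLatticeRep 2) β L
        (fun U => Real.exp (((2 : ℕ) : ℝ) * ∑ i ∈ T,
          carrierCl (fundamentalLatticeRep 2) (c₀ * (R : ℝ) ^ 4 * (2 * R + 4) ^ 4) 1 β R (q i) (x i) U)) ≤
      Real.exp (12 * (1944 + 144 * Real.log β / (2 * L + 1 : ℕ)) / c₀ * #T) := by
  have hR0 : (1 : ℝ) ≤ R := by exact_mod_cast hR
  have hR4 : (1 : ℝ) ≤ (R : ℝ) ^ 4 := one_le_pow₀ hR0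
  have h24 : (24 : ℝ) ≤ (2 * (R : ℝ) + 4) ^ 4 := by
    have h6 : (6 : ℝ) ≤ 2 * (R : ℝ) + 4 := by linarith
    have h64 : (6 : ℝ) ^ 4 ≤ (2 * (R : ℝ) + 4) ^ 4 := pow_le_pow_left₀ (by norm_num) h6 4
    linarith [show (24 : ℝ) ≤ 6 ^ 4 by norm_num]
  have hC : 24 * (R : ℝ) ^ 4 ≤ c₀ * (R : ℝ) ^ 4 * (2 * R + 4) ^ 4 := by
    nlinarith [mul_le_mul hc₀ h24 (by norm_num) (by linarith), pow_nonneg (show (0:ℝ) ≤ R by positivity) 4]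
  refine (torusE_exp_two_mul_sum_carrierCl_le_of_const hβ q x hq hR hRL hsep hC T).trans (le_of_eq ?_)
  congr 1
  have hR4ne : (R : ℝ) ^ 4 ≠ 0 := by positivity
  have h2R : (2 * (R : ℝ) + 4) ^ 4 ≠ 0 := by positivity
  have hc₀ne : c₀ ≠ 0 := by linarith
  push_cast
  field_simp

/-- **On tori `2L+1 ≥ log β`** the uniform budget is numerical: `⟨exp(2 Σ_{i∈T} carrierCl (c₀R⁴(2R+4)⁴) 1 β R (q i) (x i))⟩_{2L+1,β} ≤ exp(25056/c₀ · #T)`.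
[folklore] -/
theorem torusE_exp_two_mul_sum_carrierCl_le_uniform_of_log_le {β : ℝ} (hβ : 4 ≤ β) {L n : ℕ} (hlog : Real.log β ≤ (2 * L + 1 : ℕ))
    (q : Fin n → Fin 4 × Fin 4) (x : Fin n → (Fin 4 → ℤ)) {R : ℕ} (hq : ∀ i, (q i).1 < (q i).2) (hR : 1 ≤ R)
    (hRL : 4 * R + 8 ≤ L)
    (hsep : ∀ i j : Fin n, i ≠ j → ∃ k : Fin 4,
      (2 * (R : ℤ) + 4) ≤ |((((x i k - x j k : ℤ) : ZMod (2 * L + 1))).valMinAbs : ℤ)|)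
    {c₀ : ℝ} (hc₀ : 1 ≤ c₀) (T : Finset (Fin n)) :
    torusE (Matrix.specialUnitaryGroup (Fin 2) ℂ) (fundamentalLatticeRep 2) β L
        (fun U => Real.exp (((2 : ℕ) : ℝ) * ∑ i ∈ T,
          carrierCl (fundamentalLatticeRep 2) (c₀ * (R : ℝ) ^ 4 * (2 * R + 4) ^ 4) 1 β R (q i) (x i) U)) ≤
      Real.exp (25056 / c₀ * #T) := by
  refine (torusE_exp_two_mul_sum_carrierCl_le_uniform hβ q x hq hR hRL hsep hc₀ T).trans (Real.exp_le_exp.2 ?_)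
  have hM0 : (0 : ℝ) < ((2 * L + 1 : ℕ) : ℝ) := by positivity
  have hc₀0 : 0 < c₀ := by linarith
  have h1 : 144 * Real.log β / ((2 * L + 1 : ℕ) : ℝ) ≤ 144 := by
    rw [div_le_iff₀ hM0]; nlinarith
  have h2 : 12 * (1944 + 144 * Real.log β / ((2 * L + 1 : ℕ) : ℝ)) / c₀ ≤ 25056 / c₀ := by
    rw [div_le_div_iff_of_pos_right hc₀0]; linarith
  exact mul_le_mul_of_nonneg_right h2 (Nat.cast_nonneg _)

end Summit.QuantumFields.YangMills.Cruxes.UVSeamRec.ClassicalResponse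

end
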